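import Summits.HubbardSuperconductivity.HubbardSuperconductivity.Theses.GibbsMajorant
import Literature.MathematicalPhysics.QuantumLattice.GibbsTwoTimeBound

/-!
# Route `GibbsMajorant`: the support item `GibbsMajorantLemma` (stmt-HubbardSuperconductivity-15717)

THE LEVER of the route: for a Hermitian matrix `H`, a positive semidefinite `X`, a unit vector `ψ`
with `Hψ = Eψ` and ANY real `β`,
`Re⟨ψ, Xψ⟩ ≤ e^{βE} · Re Tr(e^{-βH} X)`.

Proof (finite-dimensional spectral calculus, Tasaki (2020) App. A; Bratteli–Robinson II §5.3.1).
Write `e^{-βH} = U diag(e^{-βλ}) U⋆` (`gibbsWeight_eq_conj_diagonal`) and put `a = U⋆ψ`,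
`c = U⋆v` for a test vector `v`.  The eigenvector equation forces `a_i = 0` unless `λ_i = E`, so
`⟨ψ, v⟩ = Σ_{λ_i = E} conj(a_i) c_i`, and Cauchy–Schwarz with `‖a‖ = 1` gives the **vector
majorant** `e^{-βE} |⟨ψ, v⟩|² ≤ Σ_{λ_i = E} e^{-βλ_i}|c_i|² ≤ Re⟨v, e^{-βH} v⟩`
(`exp_neg_mul_norm_sq_dotProduct_le`), i.e. `e^{-βH} ⪰ e^{-βE}|ψ⟩⟨ψ|`.  For `X = BᴴB`
(`CStarAlgebra.nonneg_iff_eq_star_mul_self`) sum the vector majorant over the rows `b_k` of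
`B̄`: `⟨ψ, Xψ⟩ = Σ_k |⟨ψ, b_k⟩|²` and `Σ_k ⟨b_k, e^{-βH} b_k⟩ = Tr(B e^{-βH} Bᴴ) = Tr(e^{-βH} X)`.
No definition is introduced.
-/

set_option linter.dupNamespace false

noncomputable section

open scoped Matrix.Norms.L2Operator ComplexOrder MatrixOrder ComplexConjugate
open Matrix Finset Literature.MathematicalPhysics.QuantumLattice

namespace Summit.HubbardSuperconductivity.HubbardSuperconductivity.Theorems.GibbsMajorant

variable {n : Type*} [Fintype n] [DecidableEq n]

/-! ### Quadratic forms in an orthonormal eigenbasis -/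

omit [DecidableEq n] in
/-- `⟨v, U w⟩ = ⟨Uᴴ v, w⟩` for the dot product: `star v ⬝ᵥ U *ᵥ w = star (Uᴴ *ᵥ v) ⬝ᵥ w`. [folklore] -/
theorem star_dotProduct_mulVec_eq (U : Matrix n n ℂ) (v w : n → ℂ) :
    star v ⬝ᵥ U *ᵥ w = star (Uᴴ *ᵥ v) ⬝ᵥ w := by
  rw [dotProduct_mulVec, star_mulVec, conjTranspose_conjTranspose]

/-- The quadratic form of a conjugated diagonal matrix: with `c = Uᴴ v`,
`⟨v, U diag(d) Uᴴ v⟩ = Σ_i d_i |c_i|²` (no unitarity needed). [folklore] -/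
theorem star_dotProduct_conj_diagonal_mulVec (U : Matrix n n ℂ) (d : n → ℂ) (v : n → ℂ) :
    star v ⬝ᵥ (U * diagonal d * Uᴴ) *ᵥ v = ∑ i, d i * ((‖(Uᴴ *ᵥ v) i‖ ^ 2 : ℝ) : ℂ) := by
  rw [← mulVec_mulVec, ← mulVec_mulVec, star_dotProduct_mulVec_eq, dotProduct]
  refine Finset.sum_congr rfl fun i _ => ?_
  rw [mulVec_diagonal, Pi.star_apply, Complex.star_def, Complex.ofReal_pow, ← Complex.conj_mul']
  ring

/-- `⟨ψ, v⟩ = ⟨Uᴴψ, Uᴴv⟩` when `U Uᴴ = 1`. [folklore] -/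
theorem star_dotProduct_eq_conj (U : Matrix n n ℂ) (hU : U * Uᴴ = 1) (ψ v : n → ℂ) :
    star ψ ⬝ᵥ v = star (Uᴴ *ᵥ ψ) ⬝ᵥ (Uᴴ *ᵥ v) := by
  conv_lhs => rw [← one_mulVec v, ← hU, ← mulVec_mulVec]
  rw [star_dotProduct_mulVec_eq]

/-- `‖v‖² = Σ_i |(Uᴴv)_i|²` when `U Uᴴ = 1`. [folklore] -/
theorem star_dotProduct_self_eq_sum (U : Matrix n n ℂ) (hU : U * Uᴴ = 1) (v : n → ℂ) :
    star v ⬝ᵥ v = ∑ i, ((‖(Uᴴ *ᵥ v) i‖ ^ 2 : ℝ) : ℂ) := by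
  have h := star_dotProduct_conj_diagonal_mulVec U (fun _ => (1 : ℂ)) v
  rw [diagonal_one, Matrix.mul_one, hU, one_mulVec] at h
  rw [h]
  simp only [one_mul]

/-! ### The eigenbasis of a Hermitian matrix -/

section Spectral

variable {H : Matrix n n ℂ}

/-- Spectral theorem in product form: `H = U diag(λ) Uᴴ` with `U = eigenvectorUnitary`,
`λ = eigenvalues` (Mathlib `Matrix.IsHermitian.spectral_theorem`). [folklore] -/
theorem eq_conj_diagonal_eigenvalues (hH : H.IsHermitian) :
    H = (hH.eigenvectorUnitary : Matrix n n ℂ) * diagonal (fun i => ((hH.eigenvalues i : ℝ) : ℂ)) *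
      (hH.eigenvectorUnitary : Matrix n n ℂ)ᴴ := by
  have h := hH.spectral_theorem
  rw [Unitary.conjStarAlgAut_apply, star_eq_conjTranspose] at h
  exact h

/-- `Uᴴ U = 1` for the eigenvector unitary. [folklore] -/
theorem conjTranspose_eigenvectorUnitary_mul_self (hH : H.IsHermitian) :
    (hH.eigenvectorUnitary : Matrix n n ℂ)ᴴ * (hH.eigenvectorUnitary : Matrix n n ℂ) = 1 := by
  have := Unitary.coe_star_mul_self hH.eigenvectorUnitary
  rwa [star_eq_conjTranspose] at this

/-- The Gibbs weight in product form: `e^{-βH} = U diag(e^{-βλ}) Uᴴ`. [folklore] -/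
theorem gibbsWeight_eq_conj_diagonal' (hH : H.IsHermitian) (β : ℝ) :
    gibbsWeight β H = (hH.eigenvectorUnitary : Matrix n n ℂ) *
      diagonal (fun i => (Real.exp (-β * hH.eigenvalues i) : ℂ)) *
        (hH.eigenvectorUnitary : Matrix n n ℂ)ᴴ := by
  rw [gibbsWeight_eq_conj_diagonal hH β, star_eq_conjTranspose]

/-- In the eigenbasis an eigenvector `Hψ = Eψ` has coordinates supported on `{i | λ_i = E}`:
`(Uᴴψ)_i = 0` whenever `λ_i ≠ E`. [folklore] -/
theorem eigenCoord_eq_zero_of_ne (hH : H.IsHermitian) {ψ : n → ℂ} {E : ℝ}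
    (hHψ : H *ᵥ ψ = (E : ℂ) • ψ) {i : n} (hi : hH.eigenvalues i ≠ E) :
    ((hH.eigenvectorUnitary : Matrix n n ℂ)ᴴ *ᵥ ψ) i = 0 := by
  set U : Matrix n n ℂ := (hH.eigenvectorUnitary : Matrix n n ℂ) with hU
  have hUU := conjTranspose_eigenvectorUnitary_mul_self hH
  rw [← hU] at hUU
  -- `Uᴴ H = diag(λ) Uᴴ`
  have h1 : Uᴴ *ᵥ (H *ᵥ ψ) = diagonal (fun i => ((hH.eigenvalues i : ℝ) : ℂ)) *ᵥ (Uᴴ *ᵥ ψ) := by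
    conv_lhs => rw [eq_conj_diagonal_eigenvalues hH, ← hU]
    rw [mulVec_mulVec, mulVec_mulVec, ← Matrix.mul_assoc, ← Matrix.mul_assoc, hUU, Matrix.one_mul]
  rw [hHψ, mulVec_smul] at h1
  have h2 := congrFun h1 i
  rw [Pi.smul_apply, mulVec_diagonal, smul_eq_mul] at h2
  -- `(E - λ_i) a_i = 0`
  have h3 : (((E : ℂ)) - ((hH.eigenvalues i : ℝ) : ℂ)) * (Uᴴ *ᵥ ψ) i = 0 := by
    rw [sub_mul, h2, sub_self]
  rcases mul_eq_zero.mp h3 with h | h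
  · exfalso
    apply hi
    have := sub_eq_zero.mp h
    exact_mod_cast this.symm
  · exact h

/-- **Vector majorant** `e^{-βH} ⪰ e^{-βE}|ψ⟩⟨ψ|`: for a unit eigenvector `Hψ = Eψ`, every real `β`
and every vector `v`, `e^{-βE} |⟨ψ, v⟩|² ≤ Re⟨v, e^{-βH} v⟩`. Tasaki (2020) App. A;
Bratteli–Robinson II §5.3.1. [folklore] -/
theorem exp_neg_mul_norm_sq_dotProduct_le (hH : H.IsHermitian) {ψ : n → ℂ} {E : ℝ}
    (hψ1 : star ψ ⬝ᵥ ψ = 1) (hHψ : H *ᵥ ψ = (E : ℂ) • ψ) (β : ℝ) (v : n → ℂ) :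
    Real.exp (-(β * E)) * ‖star ψ ⬝ᵥ v‖ ^ 2 ≤ (star v ⬝ᵥ gibbsWeight β H *ᵥ v).re := by
  set U : Matrix n n ℂ := (hH.eigenvectorUnitary : Matrix n n ℂ) with hU
  have hUU' : U * Uᴴ = 1 := eigenvectorUnitary_mul_conjTranspose_self hH
  set a : n → ℂ := Uᴴ *ᵥ ψ with ha
  set c : n → ℂ := Uᴴ *ᵥ v with hc
  set S : Finset n := Finset.univ.filter (fun i => hH.eigenvalues i = E) with hS
  -- (1) `‖a‖² = 1`
  have ha1 : ∑ i, ‖a i‖ ^ 2 = 1 := by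
    have h := star_dotProduct_self_eq_sum U hUU' ψ
    rw [hψ1, ← ha] at h
    exact_mod_cast h.symm
  -- (2) `⟨ψ, v⟩ = Σ_{i ∈ S} conj(a_i) c_i`
  have hdot : star ψ ⬝ᵥ v = ∑ i ∈ S, star (a i) * c i := by
    rw [star_dotProduct_eq_conj U hUU' ψ v, ← ha, ← hc, dotProduct, hS, Finset.sum_filter]
    refine Finset.sum_congr rfl fun i _ => ?_
    split_ifs with hi
    · rfl
    · rw [Pi.star_apply, ha, eigenCoord_eq_zero_of_ne hH hHψ hi, star_zero, zero_mul]
  -- (3) Cauchy–Schwarz: `|⟨ψ, v⟩|² ≤ Σ_{i ∈ S} |c_i|²`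
  have hCS : ‖star ψ ⬝ᵥ v‖ ^ 2 ≤ ∑ i ∈ S, ‖c i‖ ^ 2 := by
    have h1 : ‖star ψ ⬝ᵥ v‖ ≤ ∑ i ∈ S, ‖a i‖ * ‖c i‖ := by
      rw [hdot]
      refine (norm_sum_le _ _).trans (le_of_eq (Finset.sum_congr rfl fun i _ => ?_))
      rw [norm_mul, norm_star]
    have h2 : (∑ i ∈ S, ‖a i‖ * ‖c i‖) ^ 2 ≤ (∑ i ∈ S, ‖a i‖ ^ 2) * ∑ i ∈ S, ‖c i‖ ^ 2 :=
      Finset.sum_mul_sq_le_sq_mul_sq S (fun i => ‖a i‖) (fun i => ‖c i‖)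
    have h3 : ∑ i ∈ S, ‖a i‖ ^ 2 ≤ 1 := by
      rw [← ha1]
      exact Finset.sum_le_sum_of_subset_of_nonneg (Finset.subset_univ S)
        (fun i _ _ => sq_nonneg _)
    have h4 : 0 ≤ ∑ i ∈ S, ‖c i‖ ^ 2 := Finset.sum_nonneg fun i _ => sq_nonneg _
    calc ‖star ψ ⬝ᵥ v‖ ^ 2 ≤ (∑ i ∈ S, ‖a i‖ * ‖c i‖) ^ 2 :=
          pow_le_pow_left₀ (norm_nonneg _) h1 2
      _ ≤ (∑ i ∈ S, ‖a i‖ ^ 2) * ∑ i ∈ S, ‖c i‖ ^ 2 := h2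
      _ ≤ 1 * ∑ i ∈ S, ‖c i‖ ^ 2 := mul_le_mul_of_nonneg_right h3 h4
      _ = ∑ i ∈ S, ‖c i‖ ^ 2 := one_mul _
  -- (4) the quadratic form of `e^{-βH}`
  have hquad : (star v ⬝ᵥ gibbsWeight β H *ᵥ v).re =
      ∑ i, Real.exp (-β * hH.eigenvalues i) * ‖c i‖ ^ 2 := by
    rw [gibbsWeight_eq_conj_diagonal' hH β, ← hU, star_dotProduct_conj_diagonal_mulVec, ← hc,
      Complex.re_sum]
    refine Finset.sum_congr rfl fun i _ => ?_
    rw [← Complex.ofReal_mul, Complex.ofReal_re]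
  rw [hquad]
  -- (5) assemble
  calc Real.exp (-(β * E)) * ‖star ψ ⬝ᵥ v‖ ^ 2
      ≤ Real.exp (-(β * E)) * ∑ i ∈ S, ‖c i‖ ^ 2 :=
        mul_le_mul_of_nonneg_left hCS (Real.exp_pos _).le
    _ = ∑ i ∈ S, Real.exp (-β * hH.eigenvalues i) * ‖c i‖ ^ 2 := by
        rw [Finset.mul_sum]
        refine Finset.sum_congr rfl fun i hi => ?_
        rw [hS, Finset.mem_filter] at hi
        rw [hi.2, neg_mul]
    _ ≤ ∑ i, Real.exp (-β * hH.eigenvalues i) * ‖c i‖ ^ 2 :=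
        Finset.sum_le_sum_of_subset_of_nonneg (Finset.subset_univ S)
          (fun i _ _ => mul_nonneg (Real.exp_pos _).le (sq_nonneg _))

end Spectral

/-! ### The lever -/

/-- **`GibbsMajorantLemma` holds** (route `GibbsMajorant`, item `stmt-HubbardSuperconductivity-15717`):
for Hermitian `H`, PSD `X`, a unit vector `ψ` with `Hψ = Eψ` and any real `β`,
`Re⟨ψ, Xψ⟩ ≤ e^{βE} · Re Tr(e^{-βH} X)`. Write `X = BᴴB`; then `⟨ψ, Xψ⟩ = Σ_k |⟨ψ, b_k⟩|²` over the
rows `b_k` of `B̄`, each term is majorised by `e^{βE} Re⟨b_k, e^{-βH} b_k⟩`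
(`exp_neg_mul_norm_sq_dotProduct_le`), and `Σ_k ⟨b_k, e^{-βH} b_k⟩ = Tr(B e^{-βH} Bᴴ) = Tr(e^{-βH} X)`.
Tasaki (2020) App. A; Bratteli–Robinson II §5.3.1. [folklore] -/
theorem gibbsMajorantLemma_proof :
    Summit.HubbardSuperconductivity.HubbardSuperconductivity.Theses.GibbsMajorant.GibbsMajorantLemma := by
  unfold Summit.HubbardSuperconductivity.HubbardSuperconductivity.Theses.GibbsMajorant.GibbsMajorantLemma
  intro m _ _ H X hH hX ψ E β hψ1 hHψ
  -- `X = Bᴴ B`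
  obtain ⟨B, hB⟩ := CStarAlgebra.nonneg_iff_eq_star_mul_self.mp hX.nonneg
  rw [star_eq_conjTranspose] at hB
  set W : Matrix m m ℂ := gibbsWeight β H with hW
  -- the rows of `B̄`
  set b : m → m → ℂ := fun k => star (B k) with hb
  -- (1) `⟨ψ, Xψ⟩ = Σ_k |⟨ψ, b_k⟩|²`
  have hleft : (star ψ ⬝ᵥ X *ᵥ ψ).re = ∑ k, ‖star ψ ⬝ᵥ b k‖ ^ 2 := by
    rw [hB, ← mulVec_mulVec, star_dotProduct_mulVec_eq, conjTranspose_conjTranspose, dotProduct,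
      Complex.re_sum]
    refine Finset.sum_congr rfl fun k _ => ?_
    have hk : (B *ᵥ ψ) k = star (star ψ ⬝ᵥ b k) := by
      rw [hb, star_dotProduct, star_star, star_star]
      rfl
    rw [Pi.star_apply, hk, star_star, Complex.star_def, Complex.mul_conj', ← Complex.ofReal_pow,
      Complex.ofReal_re]
  -- (2) `Σ_k ⟨b_k, W b_k⟩ = Tr(W X)`
  have hright : ∑ k, (star (b k) ⬝ᵥ W *ᵥ b k) = (W * X).trace := by
    have hk : ∀ k, star (b k) ⬝ᵥ W *ᵥ b k = (B * (W * Bᴴ)) k k := by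
      intro k
      show star (star (B k)) ⬝ᵥ W *ᵥ star (B k) = (B * (W * Bᴴ)) k k
      rw [star_star]
      simp only [mul_apply, dotProduct, mulVec, conjTranspose_apply, Pi.star_apply]
    simp_rw [hk]
    rw [show ∑ k, (B * (W * Bᴴ)) k k = (B * (W * Bᴴ)).trace from rfl, trace_mul_comm,
      Matrix.mul_assoc, ← hB]
  -- (3) sum the vector majorant over `k`
  have hsum : Real.exp (-(β * E)) * ∑ k, ‖star ψ ⬝ᵥ b k‖ ^ 2 ≤
      ∑ k, (star (b k) ⬝ᵥ W *ᵥ b k).re := by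
    rw [Finset.mul_sum]
    exact Finset.sum_le_sum fun k _ => exp_neg_mul_norm_sq_dotProduct_le hH hψ1 hHψ β (b k)
  rw [← Complex.re_sum, hright] at hsum
  rw [hleft]
  -- (4) divide by `e^{-βE}`
  have hexp : Real.exp (β * E) * Real.exp (-(β * E)) = 1 := by
    rw [← Real.exp_add, add_neg_cancel, Real.exp_zero]
  calc ∑ k, ‖star ψ ⬝ᵥ b k‖ ^ 2
      = Real.exp (β * E) * (Real.exp (-(β * E)) * ∑ k, ‖star ψ ⬝ᵥ b k‖ ^ 2) := by
        rw [← mul_assoc, hexp, one_mul]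
    _ ≤ Real.exp (β * E) * ((W * X).trace).re :=
        mul_le_mul_of_nonneg_left hsum (Real.exp_pos _).le

end Summit.HubbardSuperconductivity.HubbardSuperconductivity.Theorems.GibbsMajorant
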